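import Summits.AtomisticToContinuum.Crystallization.Theorems.LayeredLawsSelectHcp.Negative.IntendedModel

/-!
# Negative knowledge for crux `LayeredLawsSelectHcp` (stmt-AtomisticToContinuum-9226), XVI:
# tightness of the sign in H2 — the `+y` Mecke identity fails for the intended model

Part XVI (`--supports stmt-AtomisticToContinuum-9226`). `PointStationaryPlus` is the crux's H2 with the second
argument mis-signed (`g(θ_{−y}μ, +y)` instead of `g(θ_{−y}μ, −y)`). The Palm law of hcp (part XIII) satisfies the
crux's H2 (part VII, `pointStationary_palmLaw`) but **`not_pointStationaryPlus_hcpPalm`**: it violates the `+y`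
variant — with `g(ν, y) = 1[ν = count|hcp ∧ y = b]` (`b` the `B`-site) the left side is `½` (the `A`-view sees
`b`) and the right side `0` (`θ_{−b}` of the `A`-view is the `B`-view `count|(−hcp) ≠ count|hcp` as `−b ∉ hcp`,
`neg_b_not_mem_hcpStacking` / `viewMeasure_b_ne`; and from the `B`-view the only candidate is `2b ∉ hcp`,
`two_b_not_mem_hcpStacking`, cf. `HcpNotBravais_holds`). So the convention printed in the crux is exactly the one
its witness forces (a mis-signed H2 would make the crux vacuous on its intended model), while lattice Dirac laws
(part I) satisfy both and cannot detect the sign. All `[folklore]`.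
-/

noncomputable section

namespace Summit.AtomisticToContinuum.Crystallization.Theorems.LayeredLawsSelectHcp.Negative.MeckeSign

open MeasureTheory Set
open Literature.MathematicalPhysics.StatisticalMechanics Literature.Geometry.DiscreteGeometry
open Summit.AtomisticToContinuum.Crystallization.Theses.PalmUnimodularRigidity (LayeredLawsSelectHcp)
open Summit.AtomisticToContinuum.Crystallization.Theorems.ChargedEnergyGapNegative
  (eStar eStar_le bddBelow_energyPerParticle_lennardJones)
open Summit.AtomisticToContinuum.Crystallization.Theorems.LayeredLawsSelectHcp.Negative.DiracLaws
open Summit.AtomisticToContinuum.Crystallization.Theorems.LayeredLawsSelectHcp.Negative.PeriodicPalmLaw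
open Summit.AtomisticToContinuum.Crystallization.Theorems.LayeredLawsSelectHcp.Negative.PeriodicEnergy
open Summit.AtomisticToContinuum.Crystallization.Theorems.LayeredLawsSelectHcp.Negative.HcpShells
open Summit.AtomisticToContinuum.Crystallization.Theorems.LayeredLawsSelectHcp.Negative.IntendedModel

/-- Euclidean `3`-space. [folklore] -/
local notation "E3" => EuclideanSpace ℝ (Fin 3)

/-! ## Tightness of H2's sign: the `+y` Mecke identity FAILS for the intended model -/

section MeckeSign

variable {a : ℝ}

/-- The Mecke identity with the WRONG sign in the second argument (`+y` instead of `−y`). [folklore] -/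
def PointStationaryPlus (P : Measure (Measure E3)) : Prop :=
  ∀ g : Measure E3 → E3 → ENNReal, Measurable (Function.uncurry g) →
    ∫⁻ μ, ∫⁻ y, g μ y ∂μ ∂P = ∫⁻ μ, ∫⁻ y, g (Measure.map (fun z => z - y) μ) y ∂μ ∂P

/-- `−b ∉ hcp` for the `B`-site `b = w + h e₃` (layer `−1` is in position `+w`, not `−w`). [folklore] -/
theorem neg_b_not_mem_hcpStacking {h : ℝ} (ha : a ≠ 0) (hh : h ≠ 0) :
    -barlowPos a h alternatingHagg 1 0 0 ∉ hcpStacking a h := by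
  rintro ⟨k, i, j, hk⟩
  have e2 := congrArg (fun v : E3 => v 2) hk
  simp only [PiLp.neg_apply, barlowPos_apply_two, Int.cast_one, one_mul] at e2
  have hk1 : (k : ℝ) = -1 := by
    have h0 : ((k : ℝ) + 1) * h = 0 := by linarith
    rcases mul_eq_zero.1 h0 with h0 | h0
    · linarith
    · exact absurd h0 hh
  have hk' : k = -1 := by exact_mod_cast hk1
  subst hk'
  have e1 := congrArg (fun v : E3 => v 1) hk
  have hL1 : haggLabel alternatingHagg 1 = 1 := by rw [haggLabel_alternating]; decide
  have hLm1 : haggLabel alternatingHagg (-1) = 1 := by rw [haggLabel_alternating]; decide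
  simp only [PiLp.neg_apply, barlowPos_apply_one, hL1, hLm1, Int.cast_one, Int.cast_zero, zero_add] at e1
  have h3 : (0 : ℝ) < Real.sqrt 3 := by positivity
  have hj : a * Real.sqrt 3 * (3 * (j : ℝ) + 2) = 0 := by linarith
  have hj' : 3 * (j : ℝ) + 2 = 0 := by
    rcases mul_eq_zero.1 hj with h0 | h0
    · rcases mul_eq_zero.1 h0 with h1 | h1
      · exact absurd h1 ha
      · linarith
    · exact h0
  have : (3 : ℤ) * j = -2 := by exact_mod_cast (by linarith : (3 : ℝ) * j = -2)
  omega

/-- `2b ∉ hcp` (layer `2` is in position `A`, and `2w ∉ ℤu + ℤv`; cf. `HcpNotBravais_holds`). [folklore] -/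
theorem two_b_not_mem_hcpStacking {h : ℝ} (ha : a ≠ 0) (hh : h ≠ 0) :
    barlowPos a h alternatingHagg 1 0 0 + barlowPos a h alternatingHagg 1 0 0 ∉ hcpStacking a h := by
  rintro ⟨k, i, j, hk⟩
  have e2 := congrArg (fun v : E3 => v 2) hk
  simp only [PiLp.add_apply, barlowPos_apply_two, Int.cast_one, one_mul] at e2
  have hk2 : (k : ℝ) = 2 := by
    have h0 : ((k : ℝ) - 2) * h = 0 := by linarith
    rcases mul_eq_zero.1 h0 with h0 | h0
    · linarith
    · exact absurd h0 hh
  have hk' : k = 2 := by exact_mod_cast hk2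
  subst hk'
  have e1 := congrArg (fun v : E3 => v 1) hk
  have hL1 : haggLabel alternatingHagg 1 = 1 := by rw [haggLabel_alternating]; decide
  have hL2 : haggLabel alternatingHagg 2 = 0 := by rw [haggLabel_alternating]; decide
  simp only [PiLp.add_apply, barlowPos_apply_one, hL1, hL2, Int.cast_one, Int.cast_zero, zero_div,
    add_zero, zero_add] at e1
  have h3 : (0 : ℝ) < Real.sqrt 3 := by positivity
  have hj : a * Real.sqrt 3 * (3 * (j : ℝ) - 2) = 0 := by linarith
  have hj' : 3 * (j : ℝ) - 2 = 0 := by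
    rcases mul_eq_zero.1 hj with h0 | h0
    · rcases mul_eq_zero.1 h0 with h1 | h1
      · exact absurd h1 ha
      · linarith
    · exact h0
  have : (3 : ℤ) * j = 2 := by exact_mod_cast (by linarith : (3 : ℝ) * j = 2)
  omega

/-- The two motif views of hcp differ: `hcp ≠ −hcp` (as `b ∈ hcp`, `−b ∉ hcp`). [folklore] -/
theorem viewMeasure_b_ne (ha : a ≠ 0) :
    viewMeasure (hcpQ ha) (barlowPos a (a * Real.sqrt (2 / 3)) alternatingHagg 1 0 0) ≠
      viewMeasure (hcpQ ha) 0 := by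
  intro hEq
  have hset := set_eq_of_count_restrict_eq hEq
  unfold view at hset
  rw [hcpQ_points ha, hcpStacking_sub_b_eq_neg] at hset
  have hb : barlowPos a (a * Real.sqrt (2 / 3)) alternatingHagg 1 0 0 ∈
      (fun z : E3 => z - 0) '' hcpStacking a (a * Real.sqrt (2 / 3)) :=
    ⟨_, barlowPos_mem 1 0 0, sub_zero _⟩
  rw [← hset] at hb
  obtain ⟨z, hz, hzb⟩ := hb
  have : -barlowPos a (a * Real.sqrt (2 / 3)) alternatingHagg 1 0 0 ∈ hcpStacking a (a * Real.sqrt (2 / 3)) := by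
    rw [← hzb, neg_neg]; exact hz
  exact neg_b_not_mem_hcpStacking ha (idealRatio_ne_zero ha) this

/-- **H2's sign is forced by the intended model**: the Palm law of hcp satisfies the crux's Mecke
identity (`−y`, §11) but NOT the `+y` variant — tested on `g(ν, y) = 1[ν = count|hcp ∧ y = b]`:
`E ∑_y g(μ, y) = ½` (the `A`-view sees `b`) while `E ∑_y g(θ_{−y}μ, +y) = 0` (`θ_{−b}` of the `A`-view is
the `B`-view, and `2b ∉ hcp`). A mis-signed H2 would have made the crux vacuous on its own witness.
[folklore] -/
theorem not_pointStationaryPlus_hcpPalm (ha : a ≠ 0) : ¬ PointStationaryPlus (palmLaw (hcpQ ha)) := by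
  classical
  set Q := hcpQ ha with hQ
  set b : E3 := barlowPos a (a * Real.sqrt (2 / 3)) alternatingHagg 1 0 0 with hbdef
  set ν₀ := viewMeasure Q 0 with hν₀
  have hpts : Q.points = hcpStacking a (a * Real.sqrt (2 / 3)) := hcpQ_points ha
  have hbQ : b ∈ Q.points := by rw [hpts]; exact barlowPos_mem 1 0 0
  have h0Q : (0 : E3) ∈ Q.points := by
    rw [hpts]; exact ⟨0, 0, 0, by ext l; fin_cases l <;> simp⟩
  intro H
  -- the test function
  set g : Measure E3 → E3 → ENNReal := fun ν y => if ν = ν₀ ∧ y = b then 1 else 0 with hg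
  have hmeas : Measurable (Function.uncurry g) := by
    have hset : MeasurableSet ({ν₀} ×ˢ {b} : Set (Measure E3 × E3)) :=
      (measurableSet_viewAtom Q 0).prod (measurableSet_singleton b)
    refine Measurable.ite ?_ measurable_const measurable_const
    convert hset using 1
    ext ⟨ν, y⟩
    simp
  have key := H g hmeas
  rw [lintegral_palmLaw, lintegral_palmLaw] at key
  simp_rw [lintegral_viewMeasure] at key
  -- the motif sum runs over `{0, b}`
  have hmotif : Q.motif = (Finset.range 2).image
      (fun m : ℕ => barlowPos a (a * Real.sqrt (2 / 3)) alternatingHagg m 0 0) := rfl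
  have hinj : Set.InjOn (fun m : ℕ => barlowPos a (a * Real.sqrt (2 / 3)) alternatingHagg m 0 0)
      ↑(Finset.range 2) := by
    intro m hm m' hm' hmm
    have e2 := congrArg (fun v : E3 => v 2) hmm
    simp only [barlowPos_apply_two] at e2
    have : (m : ℝ) = m' := by
      have := mul_right_cancel₀ (idealRatio_ne_zero ha) e2
      exact_mod_cast this
    exact_mod_cast this
  have hb0 : barlowPos a (a * Real.sqrt (2 / 3)) alternatingHagg (0 : ℕ) 0 0 = 0 := by
    ext l; fin_cases l <;> simp
  have hb1 : barlowPos a (a * Real.sqrt (2 / 3)) alternatingHagg (1 : ℕ) 0 0 = b := by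
    rw [hbdef]; norm_cast
  rw [hmotif, Finset.sum_image hinj, Finset.sum_image hinj, Finset.sum_range_succ, Finset.sum_range_succ,
    Finset.sum_range_zero, Finset.sum_range_succ, Finset.sum_range_succ, Finset.sum_range_zero,
    zero_add, zero_add, hb0, hb1] at key
  -- evaluate the four sums
  have hviewb : viewMeasure Q b ≠ ν₀ := viewMeasure_b_ne ha
  have L0 : ∑' p : ↥Q.points, g (viewMeasure Q 0) ((p : E3) - 0) = 1 := by
    rw [tsum_eq_single ⟨b, hbQ⟩]
    · simp [hg, hν₀]
    · intro p hp
      have hpb : (p : E3) ≠ b := fun h => hp (Subtype.ext h)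
      simp [hg, hpb]
  have Lb : ∑' p : ↥Q.points, g (viewMeasure Q b) ((p : E3) - b) = 0 := by
    refine ENNReal.tsum_eq_zero.2 fun p => ?_
    simp [hg, hviewb]
  have R0 : ∑' p : ↥Q.points, g (Measure.map (fun z => z - ((p : E3) - 0)) (viewMeasure Q 0)) ((p : E3) - 0) = 0 := by
    refine ENNReal.tsum_eq_zero.2 fun p => ?_
    rw [map_sub_viewMeasure, sub_zero, zero_add]
    by_cases hpb : (p : E3) = b
    · simp [hg, hpb, hviewb]
    · simp [hg, hpb]
  have Rb : ∑' p : ↥Q.points, g (Measure.map (fun z => z - ((p : E3) - b)) (viewMeasure Q b)) ((p : E3) - b) = 0 := by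
    refine ENNReal.tsum_eq_zero.2 fun p => ?_
    have hpb : (p : E3) - b ≠ b := by
      intro h
      have hpbb : (p : E3) = b + b := eq_add_of_sub_eq h
      have hp2 : b + b ∈ Q.points := hpbb ▸ p.2
      rw [hpts] at hp2
      exact two_b_not_mem_hcpStacking ha (idealRatio_ne_zero ha) hp2
    simp [hg, hpb]
  rw [L0, Lb, R0, Rb] at key
  simp at key

end MeckeSign

end Summit.AtomisticToContinuum.Crystallization.Theorems.LayeredLawsSelectHcp.Negative.MeckeSign

end
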